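import Literature.NumberTheory.Transcendental.CurvePeriodsEllipticFormsProofs

/-!
# KontsevichZagierPeriods — kz1p class E1 derivations: CM automorphisms as (R4) in the formal period space

Cell pub-kz1p (KZ 1-periods), seat b2b-kz1p-1, gen 16; helper of the rung-1 item, companion of
`KzOnePeriodsE1CMCurves.lean` (CM relations of lattice periods) and of seat 2's `KzOnePeriodsG0Deriv*.lean`.
Pure mathematics over the tree's formal period space `CurvePeriods` (Huber–Wüstholz 2022, §13.1 (A)–(B),
Thm. 13.3 (2)); no named facts, no `sorry`, no new definitions.

General part.  For a polynomial map `f : Z → Z′` over `ℚ̄` of smooth affine curves and a `C¹` path `γ` on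
`Z` with algebraic end points, `f ∘ γ` is such a path on `Z′` (`exists_imagePath`), and for every `γ′` agreeing
with `f ∘ γ` on `[0, 1]` (R4) reads `(Z, f^*ω′, γ) ∼ (Z′, ω′, γ′)`.  If `f^*ω′ = u·ω` EXACTLY as polynomial
forms, `u ∈ ℚ̄`, then with (R1) `(Z′, ω′, γ′) − u·(Z, ω, γ) ∈ ⟨(R1)–(R5)⟩_ℚ̄` (`span_image_of_formPullback_eq`)
and, by the tree's soundness theorem for (R1)–(R5), `∫_{γ′} ω′ = u ∫_γ ω` (`image_of_formPullback_eq`).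

Elliptic part.  On the plane model `E_{A,B} : y² = x³ + Ax + B` (`weierCurve A B`) with the tree's
polynomial representatives `θ₀` of `dx/y` (`Weier.theta0`) and `xθ₀ = x·θ₀` of `x dx/y`, the LINEAR maps
* `[−1] : (x, y) ↦ (x, −y)` of every `E_{A,B}`:                 `[−1]^*θ₀ = −θ₀`, `[−1]^*(xθ₀) = −xθ₀`;
* `[d] : (x, y) ↦ (−x, d·y)`, `d² = −1`, of `E_{A,0}` (`j = 1728`): `[d]^*θ₀ = d·θ₀`, `[d]^*(xθ₀) = −d·xθ₀`;
* `[u] : (x, y) ↦ (u·x, y)`, `u³ = 1`, of `E_{0,B}` (`j = 0`):     `[u]^*θ₀ = u·θ₀`, `[u]^*(xθ₀) = u²·xθ₀`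
satisfy these pull-back formulas as EXACT identities of polynomial forms; whence follow, for EVERY `C¹` path `γ`
on the curve with algebraic end points and its image `γ′`, the connected derivations and period identities of E1-01
(`W([i]γ) = iW(γ)`), E1-02 (`H([i]γ) = −iH(γ)`) on `y² = x³ + ax`, `a = −1, −25, −1156, −36` (`corpus_cmI`),
and E1-11 (`W([ρ]γ) = ρW(γ)`, `H([ρ]γ) = ρ²H(γ)`) on `y² = x³ + 1` (`corpus_cmU`), in the relation format of
`HuberWustholzCurvePeriods`.  This is the unit case (automorphisms) of the tree's CM functoriality
`Ell.CMReps.span_cmul_theta0/theta1` (`CurvePeriodsEllipticCMIsogenyProofs.lean`: analytic model `E_L`,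
`℘`-parametrised paths avoiding `α⁻¹Λ`) and of `Ell.exists_cm_loop_relations` (closed paths, `∃`-quantified
coefficients); new here: plane packet model, explicit linear maps, every path, exact coefficients.
-/

noncomputable section

open MvPolynomial Set Complex
open Literature.NumberTheory.Transcendental Literature.NumberTheory.Transcendental.CurvePeriods

namespace Summit.KontsevichZagierPeriods.KzOnePeriods.E1Derivation

local notation3 "InSpanRel " c:arg => ∃ (k : ℕ) (ρ : Fin k → (PeriodSymbol →₀ ℂ))
  (a : Fin k → ℂ), (∀ l, IsElementaryRelation (ρ l)) ∧ (∀ l, IsAlgebraic ℚ (a l)) ∧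
    c = ∑ l, a l • ρ l

/-- The symbol `(Z, ω, γ)` as an element of the formal period space. -/
local notation3 (prettyPrint := false) "Sy[" Z ", " hZ ", " ω ", " h ", " γ "]" =>
  (Finsupp.single (⟨Z, hZ, ω, h, γ⟩ : PeriodSymbol) (1 : ℂ) : PeriodSymbol →₀ ℂ)

/-- The period `∫_γ ω` of the symbol `(Z, ω, γ)`. -/
local notation3 (prettyPrint := false) "Pe[" Z ", " hZ ", " ω ", " h ", " γ "]" =>
  PeriodSymbol.period (⟨Z, hZ, ω, h, γ⟩ : PeriodSymbol)

/-! ### Images of paths under polynomial maps; (R4) and (R1) for exact eigenforms -/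

/-- **The image path.**  For a polynomial map `f : Z → Z′` over `ℚ̄` and a `C¹` path `γ` on `Z` with
algebraic end points, `f ∘ γ` is a `C¹` path on `Z′` with algebraic end points. -/
theorem exists_imagePath {Z Z' : CurveData} (f : Fin Z'.n → MvPolynomial (Fin Z.n) ℂ)
    (hf : ∀ j, HasAlgCoeffs (f j)) (hfZ : ∀ z ∈ Z.points, (fun j => eval z (f j)) ∈ Z'.points)
    (γ : CurvePath Z) : ∃ γ' : CurvePath Z', ∀ t, γ'.toFun t = fun j => eval (γ.toFun t) (f j) :=
  ⟨{ toFun := fun t j => eval (γ.toFun t) (f j)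
     contDiffOn := contDiffOn_pi' fun j => contDiffOn_eval_comp γ.contDiffOn (f j)
     mem_points := fun t ht => hfZ _ (γ.mem_points t ht)
     algebraic_zero := fun j => (hf j).isAlgebraic_eval γ.algebraic_zero
     algebraic_one := fun j => (hf j).isAlgebraic_eval γ.algebraic_one }, fun _ => rfl⟩

/-- **Eigenform derivation.**  If `f^*ω′ = u·ω` exactly, `u ∈ ℚ̄`, and `γ′ = f ∘ γ` on `[0, 1]`, then
`(Z′, ω′, γ′) − u·(Z, ω, γ) ∈ ⟨(R1)–(R5)⟩_ℚ̄`: the (R1) relation `(Z, f^*ω′, γ) − u·(Z, ω, γ)` minus the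
(R4) relation `(Z, f^*ω′, γ) − (Z′, ω′, γ′)` (Huber–Wüstholz 2022, §13.1 (A), (B)). -/
theorem span_image_of_formPullback_eq {Z Z' : CurveData} (hZ : Z.IsSmoothAffineCurve)
    (hZ' : Z'.IsSmoothAffineCurve) (f : Fin Z'.n → MvPolynomial (Fin Z.n) ℂ)
    (hf : ∀ j, HasAlgCoeffs (f j)) (hfZ : ∀ z ∈ Z.points, (fun j => eval z (f j)) ∈ Z'.points)
    (ω' : Fin Z'.n → MvPolynomial (Fin Z'.n) ℂ) (h' : ∀ j, HasAlgCoeffs (ω' j))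
    (ω : Fin Z.n → MvPolynomial (Fin Z.n) ℂ) (h : ∀ i, HasAlgCoeffs (ω i)) {u : ℂ}
    (hu : IsAlgebraic ℚ u) (he : formPullback f ω' = u • ω) {γ : CurvePath Z} {γ' : CurvePath Z'}
    (hγ' : ∀ t ∈ Icc (0 : ℝ) 1, γ'.toFun t = fun j => eval (γ.toFun t) (f j)) :
    InSpanRel (Sy[Z', hZ', ω', h', γ'] - u • Sy[Z, hZ, ω, h, γ]) := by
  obtain ⟨k, ρ, a, hρ, ha, hs⟩ := span_sub
    (span_of_rel (IsElementaryRelation.smul Z hZ γ u hu ω (formPullback f ω') h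
      (HasAlgCoeffs.formPullback hf h') he))
    (span_of_rel (IsElementaryRelation.pushforward Z Z' hZ hZ' f hf hfZ ω' h' (formPullback f ω')
      (HasAlgCoeffs.formPullback hf h') rfl γ γ' hγ'))
  exact ⟨k, ρ, a, hρ, ha, by rw [← hs]; abel⟩

/-- **Derivation and period identity** for an exact eigenform `f^*ω′ = u·ω`, `u ∈ ℚ̄`, and `γ′ = f ∘ γ` on
`[0, 1]`: `(Z′, ω′, γ′) − u·(Z, ω, γ) ∈ ⟨(R1)–(R5)⟩_ℚ̄` and, by the soundness of (R1)–(R5)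
(`evalCombination_eq_zero_of_isElementaryRelation`), `∫_{γ′} ω′ = u ∫_γ ω`. -/
theorem image_of_formPullback_eq {Z Z' : CurveData} (hZ : Z.IsSmoothAffineCurve)
    (hZ' : Z'.IsSmoothAffineCurve) (f : Fin Z'.n → MvPolynomial (Fin Z.n) ℂ)
    (hf : ∀ j, HasAlgCoeffs (f j)) (hfZ : ∀ z ∈ Z.points, (fun j => eval z (f j)) ∈ Z'.points)
    (ω' : Fin Z'.n → MvPolynomial (Fin Z'.n) ℂ) (h' : ∀ j, HasAlgCoeffs (ω' j))
    (ω : Fin Z.n → MvPolynomial (Fin Z.n) ℂ) (h : ∀ i, HasAlgCoeffs (ω i)) {u : ℂ}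
    (hu : IsAlgebraic ℚ u) (he : formPullback f ω' = u • ω) {γ : CurvePath Z} {γ' : CurvePath Z'}
    (hγ' : ∀ t ∈ Icc (0 : ℝ) 1, γ'.toFun t = fun j => eval (γ.toFun t) (f j)) :
    InSpanRel (Sy[Z', hZ', ω', h', γ'] - u • Sy[Z, hZ, ω, h, γ]) ∧
      Pe[Z', hZ', ω', h', γ'] = u * Pe[Z, hZ, ω, h, γ] := by
  have hs := span_image_of_formPullback_eq hZ hZ' f hf hfZ ω' h' ω h hu he hγ'
  refine ⟨hs, ?_⟩
  obtain ⟨k, ρ, a, hρ, ha, hc⟩ := hs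
  have h0 := evalCombination_eq_zero_of_isElementaryRelation ρ a hρ
  rw [← hc, sub_eq_add_neg, ← neg_smul, evalCombination_add, evalCombination_smul,
    evalCombination_single, evalCombination_single] at h0
  linear_combination h0

/-- A polynomial form on the plane pulled back along a plane map, componentwise. -/
theorem formPullback_two (f ω : Fin 2 → MvPolynomial (Fin 2) ℂ) (i : Fin 2) :
    formPullback f ω i = bind₁ f (ω 0) * pderiv i (f 0) + bind₁ f (ω 1) * pderiv i (f 1) := by
  simp [formPullback, Fin.sum_univ_two]

/-- Pull-back of `x·ω` along a plane map `f = (f₀, f₁)`: `f^*(x·ω) = f₀ · f^*ω`. -/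
theorem formPullback_X_zero_smul (f ω : Fin 2 → MvPolynomial (Fin 2) ℂ) :
    formPullback f ((X 0 : MvPolynomial (Fin 2) ℂ) • ω) = f 0 • formPullback f ω := by
  funext i
  simp only [formPullback_two, Pi.smul_apply, smul_eq_mul, map_mul, bind₁_X_right]
  ring

/-! ### The plane model `E_{A,B}`: three linear automorphisms and their exact pull-back formulas -/

section Weierstrass

open Weier

/-- `x·θ₀`, the tree's polynomial representative of `x dx/y` on `E_{A,B}`. -/
local notation3 (prettyPrint := false) "xθ₀[" A ", " B "]" =>
  ((X 0 : MvPolynomial (Fin 2) ℂ) • Weier.theta0 A B)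

/-- The inversion `[−1] : (x, y) ↦ (x, −y)` as a polynomial map of the plane. -/
local notation3 (prettyPrint := false) "negM" => (![X 0, -X 1] : Fin 2 → MvPolynomial (Fin 2) ℂ)

/-- The automorphism `[d] : (x, y) ↦ (−x, d·y)` (`d² = −1`) of `E_{A,0}` as a polynomial map. -/
local notation3 (prettyPrint := false) "cmI[" d "]" =>
  (![-X 0, C d * X 1] : Fin 2 → MvPolynomial (Fin 2) ℂ)

/-- The automorphism `[u] : (x, y) ↦ (u·x, y)` (`u³ = 1`) of `E_{0,B}` as a polynomial map. -/
local notation3 (prettyPrint := false) "cmU[" u "]" =>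
  (![C u * X 0, X 1] : Fin 2 → MvPolynomial (Fin 2) ℂ)

/-- `4A³ ≠ 0` for `A ≠ 0`: `E_{A,0}` is smooth. -/
theorem disc_ne_zero_left {A : ℂ} (hA : A ≠ 0) : disc A 0 ≠ 0 := fun h =>
  pow_ne_zero 3 hA (by simp only [disc] at h; linear_combination h / 4)

/-- A square root of `−1` is algebraic. -/
theorem isAlgebraic_of_sq_eq_neg_one {d : ℂ} (hd : d ^ 2 = -1) : IsAlgebraic ℚ d :=
  IsAlgebraic.of_pow (by norm_num : 0 < 2) (by rw [hd]; exact isAlgebraic_one.neg)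

/-- A cube root of `1` is algebraic. -/
theorem isAlgebraic_of_cube_eq_one {u : ℂ} (hu : u ^ 3 = 1) : IsAlgebraic ℚ u :=
  IsAlgebraic.of_pow (by norm_num : 0 < 3) (by rw [hu]; exact isAlgebraic_one)

/-- `[−1]` is defined over `ℚ̄`. -/
theorem hasAlgCoeffs_negMap : ∀ j, HasAlgCoeffs ((negM) j) := fun j => by
  fin_cases j
  · simpa using hasAlgCoeffs_X (n := 2) 0
  · simpa using (hasAlgCoeffs_X (n := 2) 1).neg

/-- `[d]` is defined over `ℚ̄`. -/
theorem hasAlgCoeffs_cmMapI {d : ℂ} (hd : d ^ 2 = -1) : ∀ j, HasAlgCoeffs ((cmI[d]) j) := fun j => by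
  fin_cases j
  · simpa using (hasAlgCoeffs_X (n := 2) 0).neg
  · simpa using (hasAlgCoeffs_C (isAlgebraic_of_sq_eq_neg_one hd)).mul (hasAlgCoeffs_X (n := 2) 1)

/-- `[u]` is defined over `ℚ̄`. -/
theorem hasAlgCoeffs_cmMapU {u : ℂ} (hu : u ^ 3 = 1) : ∀ j, HasAlgCoeffs ((cmU[u]) j) := fun j => by
  fin_cases j
  · simpa using (hasAlgCoeffs_C (isAlgebraic_of_cube_eq_one hu)).mul (hasAlgCoeffs_X (n := 2) 0)
  · simpa using hasAlgCoeffs_X (n := 2) 1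

/-- `[−1](z) = (z₀, −z₁)`. -/
theorem eval_negMap (z : Fin 2 → ℂ) : (fun j => eval z ((negM) j)) = ![z 0, -z 1] := by
  funext j; fin_cases j <;> simp

/-- `[d](z) = (−z₀, d z₁)`. -/
theorem eval_cmMapI (d : ℂ) (z : Fin 2 → ℂ) : (fun j => eval z ((cmI[d]) j)) = ![-z 0, d * z 1] := by
  funext j; fin_cases j <;> simp

/-- `[u](z) = (u z₀, z₁)`. -/
theorem eval_cmMapU (u : ℂ) (z : Fin 2 → ℂ) : (fun j => eval z ((cmU[u]) j)) = ![u * z 0, z 1] := by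
  funext j; fin_cases j <;> simp

/-- `[−1]` preserves every `E_{A,B}`. -/
theorem negMap_mem (A B : ℂ) :
    ∀ z ∈ (weierCurve A B).points, (fun j => eval z ((negM) j)) ∈ (weierCurve A B).points := by
  intro z hz
  rw [mem_points_iff, eval_fPoly] at hz ⊢
  simp only [Matrix.cons_val_one, Matrix.cons_val_zero, map_neg, eval_X]
  linear_combination hz

/-- `[d]` (`d² = −1`) preserves `E_{A,0}`: `(d y)² = −y² = (−x)³ + A(−x)`. -/
theorem cmMapI_mem (A : ℂ) {d : ℂ} (hd : d ^ 2 = -1) :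
    ∀ z ∈ (weierCurve A 0).points, (fun j => eval z ((cmI[d]) j)) ∈ (weierCurve A 0).points := by
  intro z hz
  rw [mem_points_iff, eval_fPoly] at hz ⊢
  simp only [Matrix.cons_val_one, Matrix.cons_val_zero, map_neg, map_mul, eval_C, eval_X]
  linear_combination (-1 : ℂ) * hz + z 1 ^ 2 * hd

/-- `[u]` (`u³ = 1`) preserves `E_{0,B}`: `y² = (u x)³ + B`. -/
theorem cmMapU_mem (B : ℂ) {u : ℂ} (hu : u ^ 3 = 1) :
    ∀ z ∈ (weierCurve 0 B).points, (fun j => eval z ((cmU[u]) j)) ∈ (weierCurve 0 B).points := by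
  intro z hz
  rw [mem_points_iff, eval_fPoly] at hz ⊢
  simp only [Matrix.cons_val_one, Matrix.cons_val_zero, map_mul, eval_C, eval_X]
  linear_combination hz - z 0 ^ 3 * hu

/-- `[−1]^*θ₀ = −θ₀`, exactly. -/
theorem formPullback_negMap_theta0 (A B : ℂ) : formPullback negM (theta0 A B) = (-1 : ℂ) • theta0 A B := by
  funext i
  rw [formPullback_two, Pi.smul_apply, smul_eq_C_mul]
  fin_cases i <;> simp [theta0, uPol, vPol]

/-- `[d]^*θ₀ = d·θ₀` on `E_{A,0}`, exactly. -/
theorem formPullback_cmMapI_theta0 (A d : ℂ) : formPullback cmI[d] (theta0 A 0) = d • theta0 A 0 := by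
  funext i
  rw [formPullback_two, Pi.smul_apply, smul_eq_C_mul]
  fin_cases i
  · simp [theta0, uPol, vPol]
    ring
  · simp [theta0, uPol, vPol]
    ring

/-- `[u]^*θ₀ = u·θ₀` on `E_{0,B}`, exactly. -/
theorem formPullback_cmMapU_theta0 (B u : ℂ) : formPullback cmU[u] (theta0 0 B) = u • theta0 0 B := by
  funext i
  rw [formPullback_two, Pi.smul_apply, smul_eq_C_mul]
  fin_cases i
  · simp [theta0, uPol, vPol]
    ring
  · simp [theta0, uPol, vPol]
    ring

/-- `[−1]^*(xθ₀) = −xθ₀`, exactly. -/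
theorem formPullback_negMap_xtheta0 (A B : ℂ) :
    formPullback negM xθ₀[A, B] = (-1 : ℂ) • xθ₀[A, B] := by
  rw [formPullback_X_zero_smul, formPullback_negMap_theta0]
  funext i
  simp only [Pi.smul_apply, smul_eq_mul, smul_eq_C_mul, Matrix.cons_val_zero]
  ring

/-- `[d]^*(xθ₀) = −d·xθ₀` on `E_{A,0}`, exactly. -/
theorem formPullback_cmMapI_xtheta0 (A d : ℂ) :
    formPullback cmI[d] xθ₀[A, 0] = (-d) • xθ₀[A, 0] := by
  rw [formPullback_X_zero_smul, formPullback_cmMapI_theta0]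
  funext i
  simp only [Pi.smul_apply, smul_eq_mul, smul_eq_C_mul, Matrix.cons_val_zero, map_neg]
  ring

/-- `[u]^*(xθ₀) = u²·xθ₀` on `E_{0,B}`, exactly. -/
theorem formPullback_cmMapU_xtheta0 (B u : ℂ) :
    formPullback cmU[u] xθ₀[0, B] = (u ^ 2) • xθ₀[0, B] := by
  rw [formPullback_X_zero_smul, formPullback_cmMapU_theta0]
  funext i
  simp only [Pi.smul_apply, smul_eq_mul, smul_eq_C_mul, Matrix.cons_val_zero, map_pow]
  ring

/-! ### The derivations and period identities, for every path on the curve -/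

variable {A B : ℂ}

/-- Every path `γ` on `E_{A,B}` has its image `[−1]γ = (x∘γ, −y∘γ)` on `E_{A,B}`. -/
theorem exists_negPath (γ : CurvePath (weierCurve A B)) :
    ∃ γ' : CurvePath (weierCurve A B), ∀ t, γ'.toFun t = ![γ.toFun t 0, -γ.toFun t 1] :=
  (exists_imagePath (Z := weierCurve A B) (Z' := weierCurve A B) negM hasAlgCoeffs_negMap
    (negMap_mem A B) γ).imp fun _ h t => (h t).trans (eval_negMap _)

/-- Every path `γ` on `E_{A,0}` has its image `[d]γ = (−x∘γ, d·y∘γ)` on `E_{A,0}` (`d² = −1`). -/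
theorem exists_cmIPath {d : ℂ} (hd : d ^ 2 = -1) (γ : CurvePath (weierCurve A 0)) :
    ∃ γ' : CurvePath (weierCurve A 0), ∀ t, γ'.toFun t = ![-γ.toFun t 0, d * γ.toFun t 1] :=
  (exists_imagePath (Z := weierCurve A 0) (Z' := weierCurve A 0) cmI[d] (hasAlgCoeffs_cmMapI hd)
    (cmMapI_mem A hd) γ).imp fun _ h t => (h t).trans (eval_cmMapI d _)

/-- Every path `γ` on `E_{0,B}` has its image `[u]γ = (u·x∘γ, y∘γ)` on `E_{0,B}` (`u³ = 1`). -/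
theorem exists_cmUPath {u : ℂ} (hu : u ^ 3 = 1) (γ : CurvePath (weierCurve 0 B)) :
    ∃ γ' : CurvePath (weierCurve 0 B), ∀ t, γ'.toFun t = ![u * γ.toFun t 0, γ.toFun t 1] :=
  (exists_imagePath (Z := weierCurve 0 B) (Z' := weierCurve 0 B) cmU[u] (hasAlgCoeffs_cmMapU hu)
    (cmMapU_mem B hu) γ).imp fun _ h t => (h t).trans (eval_cmMapU u _)

/-- **`[−1]` on `E_{A,B}`**: for `ω = θ₀` and `ω = xθ₀`, every path `γ` and `γ′ = [−1]γ = (x∘γ, −y∘γ)` on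
`[0, 1]`: `(E, ω, γ′) + (E, ω, γ) ∈ ⟨(R1)–(R5)⟩_ℚ̄` and `∫_{γ′} ω = −∫_γ ω`. -/
theorem neg_derivations (hE : (weierCurve A B).IsSmoothAffineCurve) (hθ : ∀ k, HasAlgCoeffs (theta0 A B k))
    (hxθ : ∀ k, HasAlgCoeffs (xθ₀[A, B] k)) {γ γ' : CurvePath (weierCurve A B)}
    (hγ' : ∀ t ∈ Icc (0 : ℝ) 1, γ'.toFun t = ![γ.toFun t 0, -γ.toFun t 1]) :
    (InSpanRel (Sy[weierCurve A B, hE, theta0 A B, hθ, γ'] - (-1 : ℂ) • Sy[weierCurve A B, hE, theta0 A B, hθ, γ]) ∧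
      Pe[weierCurve A B, hE, theta0 A B, hθ, γ'] = -1 * Pe[weierCurve A B, hE, theta0 A B, hθ, γ]) ∧
    (InSpanRel (Sy[weierCurve A B, hE, xθ₀[A, B], hxθ, γ'] - (-1 : ℂ) • Sy[weierCurve A B, hE, xθ₀[A, B], hxθ, γ]) ∧
      Pe[weierCurve A B, hE, xθ₀[A, B], hxθ, γ'] = -1 * Pe[weierCurve A B, hE, xθ₀[A, B], hxθ, γ]) :=
  have h1 : IsAlgebraic ℚ (-1 : ℂ) := isAlgebraic_one.neg
  have hγ : ∀ t ∈ Icc (0 : ℝ) 1, γ'.toFun t = fun j => eval (γ.toFun t) ((negM) j) :=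
    fun t ht => (hγ' t ht).trans (eval_negMap _).symm
  ⟨image_of_formPullback_eq hE hE _ hasAlgCoeffs_negMap (negMap_mem A B) _ hθ _ hθ h1
      (formPullback_negMap_theta0 A B) hγ,
    image_of_formPullback_eq hE hE _ hasAlgCoeffs_negMap (negMap_mem A B) _ hxθ _ hxθ h1
      (formPullback_negMap_xtheta0 A B) hγ⟩

/-- **`[d]` on `E_{A,0}` (`d² = −1`; `j = 1728`, CM by `ℤ[i]`)**: for every path `γ` and `γ′ = [d]γ =
(−x∘γ, d·y∘γ)` on `[0, 1]`: `(E, θ₀, γ′) − d·(E, θ₀, γ) ∈ ⟨(R1)–(R5)⟩_ℚ̄` and `∫_{γ′} θ₀ = d ∫_γ θ₀`;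
`(E, xθ₀, γ′) + d·(E, xθ₀, γ) ∈ ⟨(R1)–(R5)⟩_ℚ̄` and `∫_{γ′} xθ₀ = −d ∫_γ xθ₀`. -/
theorem cmI_derivations {d : ℂ} (hd : d ^ 2 = -1) (hE : (weierCurve A 0).IsSmoothAffineCurve)
    (hθ : ∀ k, HasAlgCoeffs (theta0 A 0 k)) (hxθ : ∀ k, HasAlgCoeffs (xθ₀[A, 0] k))
    {γ γ' : CurvePath (weierCurve A 0)} (hγ' : ∀ t ∈ Icc (0 : ℝ) 1, γ'.toFun t = ![-γ.toFun t 0, d * γ.toFun t 1]) :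
    (InSpanRel (Sy[weierCurve A 0, hE, theta0 A 0, hθ, γ'] - d • Sy[weierCurve A 0, hE, theta0 A 0, hθ, γ]) ∧
      Pe[weierCurve A 0, hE, theta0 A 0, hθ, γ'] = d * Pe[weierCurve A 0, hE, theta0 A 0, hθ, γ]) ∧
    (InSpanRel (Sy[weierCurve A 0, hE, xθ₀[A, 0], hxθ, γ'] - (-d) • Sy[weierCurve A 0, hE, xθ₀[A, 0], hxθ, γ]) ∧
      Pe[weierCurve A 0, hE, xθ₀[A, 0], hxθ, γ'] = -d * Pe[weierCurve A 0, hE, xθ₀[A, 0], hxθ, γ]) :=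
  have h1 : IsAlgebraic ℚ d := isAlgebraic_of_sq_eq_neg_one hd
  have hγ : ∀ t ∈ Icc (0 : ℝ) 1, γ'.toFun t = fun j => eval (γ.toFun t) ((cmI[d]) j) :=
    fun t ht => (hγ' t ht).trans (eval_cmMapI d _).symm
  ⟨image_of_formPullback_eq hE hE _ (hasAlgCoeffs_cmMapI hd) (cmMapI_mem A hd) _ hθ _ hθ h1
      (formPullback_cmMapI_theta0 A d) hγ,
    image_of_formPullback_eq hE hE _ (hasAlgCoeffs_cmMapI hd) (cmMapI_mem A hd) _ hxθ _ hxθ h1.neg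
      (formPullback_cmMapI_xtheta0 A d) hγ⟩

/-- **`[u]` on `E_{0,B}` (`u³ = 1`; `j = 0`, CM by `ℤ[ρ]`)**: for every path `γ` and `γ′ = [u]γ = (u·x∘γ, y∘γ)`
on `[0, 1]`: `(E, θ₀, γ′) − u·(E, θ₀, γ) ∈ ⟨(R1)–(R5)⟩_ℚ̄` and `∫_{γ′} θ₀ = u ∫_γ θ₀`;
`(E, xθ₀, γ′) − u²·(E, xθ₀, γ) ∈ ⟨(R1)–(R5)⟩_ℚ̄` and `∫_{γ′} xθ₀ = u² ∫_γ xθ₀`. -/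
theorem cmU_derivations {u : ℂ} (hu : u ^ 3 = 1) (hE : (weierCurve 0 B).IsSmoothAffineCurve)
    (hθ : ∀ k, HasAlgCoeffs (theta0 0 B k)) (hxθ : ∀ k, HasAlgCoeffs (xθ₀[0, B] k))
    {γ γ' : CurvePath (weierCurve 0 B)} (hγ' : ∀ t ∈ Icc (0 : ℝ) 1, γ'.toFun t = ![u * γ.toFun t 0, γ.toFun t 1]) :
    (InSpanRel (Sy[weierCurve 0 B, hE, theta0 0 B, hθ, γ'] - u • Sy[weierCurve 0 B, hE, theta0 0 B, hθ, γ]) ∧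
      Pe[weierCurve 0 B, hE, theta0 0 B, hθ, γ'] = u * Pe[weierCurve 0 B, hE, theta0 0 B, hθ, γ]) ∧
    (InSpanRel (Sy[weierCurve 0 B, hE, xθ₀[0, B], hxθ, γ'] - (u ^ 2) • Sy[weierCurve 0 B, hE, xθ₀[0, B], hxθ, γ]) ∧
      Pe[weierCurve 0 B, hE, xθ₀[0, B], hxθ, γ'] = u ^ 2 * Pe[weierCurve 0 B, hE, xθ₀[0, B], hxθ, γ]) :=
  have h1 : IsAlgebraic ℚ u := isAlgebraic_of_cube_eq_one hu
  have hγ : ∀ t ∈ Icc (0 : ℝ) 1, γ'.toFun t = fun j => eval (γ.toFun t) ((cmU[u]) j) :=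
    fun t ht => (hγ' t ht).trans (eval_cmMapU u _).symm
  ⟨image_of_formPullback_eq hE hE _ (hasAlgCoeffs_cmMapU hu) (cmMapU_mem B hu) _ hθ _ hθ h1
      (formPullback_cmMapU_theta0 B u) hγ,
    image_of_formPullback_eq hE hE _ (hasAlgCoeffs_cmMapU hu) (cmMapU_mem B hu) _ hxθ _ hxθ (h1.pow 2)
      (formPullback_cmMapU_xtheta0 B u) hγ⟩

/-! ### The corpus curves -/

/-- The corpus curves `y² = x³ + ax`, `a = −1, −25, −1156, −36` (tests E1-01/02/03, E1-12, E1-16…22, E1-26):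
`a` is algebraic and nonzero. -/
theorem corpus_a {a : ℂ} (ha : a = -1 ∨ a = -25 ∨ a = -1156 ∨ a = -36) : IsAlgebraic ℚ a ∧ a ≠ 0 := by
  rcases ha with rfl | rfl | rfl | rfl
  exacts [⟨by simpa using (isAlgebraic_nat (R := ℚ) (A := ℂ) 1).neg, by norm_num⟩,
    ⟨by simpa using (isAlgebraic_nat (R := ℚ) (A := ℂ) 25).neg, by norm_num⟩,
    ⟨by simpa using (isAlgebraic_nat (R := ℚ) (A := ℂ) 1156).neg, by norm_num⟩,
    ⟨by simpa using (isAlgebraic_nat (R := ℚ) (A := ℂ) 36).neg, by norm_num⟩]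

/-- The corpus curves `E_{a,0}` are smooth affine curves over `ℚ̄`. -/
theorem corpus_smoothI {a : ℂ} (ha : a = -1 ∨ a = -25 ∨ a = -1156 ∨ a = -36) :
    (weierCurve a 0).IsSmoothAffineCurve :=
  isSmoothAffineCurve a 0 (corpus_a ha).1 isAlgebraic_zero (disc_ne_zero_left (corpus_a ha).2)

/-- `θ₀` and `xθ₀` on the corpus curves `E_{a,0}` are defined over `ℚ̄`. -/
theorem corpus_formsI {a : ℂ} (ha : a = -1 ∨ a = -25 ∨ a = -1156 ∨ a = -36) :
    (∀ k, HasAlgCoeffs (theta0 a 0 k)) ∧ ∀ k, HasAlgCoeffs (xθ₀[a, 0] k) :=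
  ⟨hasAlgCoeffs_theta0 a 0 (corpus_a ha).1 isAlgebraic_zero,
    hasAlgCoeffs_smul_theta0 a 0 (corpus_a ha).1 isAlgebraic_zero (hasAlgCoeffs_X 0)⟩

/-- **Tests E1-01, E1-02** (`W([i]γ) = iW(γ)`, `H([i]γ) = −iH(γ)`; verdict `relation`, exhibited): on
`y² = x³ + ax`, `a ∈ {−1, −25, −1156, −36}`, for EVERY `C¹` path `γ` with algebraic end points and its image
`γ′ = [i]γ = (−x∘γ, i·y∘γ)` on `[0, 1]` (which exists, `exists_cmIPath`):
`(E, θ₀, γ′) − i·(E, θ₀, γ) ∈ ⟨(R1)–(R5)⟩_ℚ̄` and `∫_{γ′} dx/y = i ∫_γ dx/y`;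
`(E, xθ₀, γ′) + i·(E, xθ₀, γ) ∈ ⟨(R1)–(R5)⟩_ℚ̄` and `∫_{γ′} x dx/y = −i ∫_γ x dx/y`. -/
theorem corpus_cmI {a : ℂ} (ha : a = -1 ∨ a = -25 ∨ a = -1156 ∨ a = -36) {γ γ' : CurvePath (weierCurve a 0)}
    (hγ' : ∀ t ∈ Icc (0 : ℝ) 1, γ'.toFun t = ![-γ.toFun t 0, I * γ.toFun t 1]) :
    (InSpanRel (Sy[weierCurve a 0, corpus_smoothI ha, theta0 a 0, (corpus_formsI ha).1, γ'] -
        I • Sy[weierCurve a 0, corpus_smoothI ha, theta0 a 0, (corpus_formsI ha).1, γ]) ∧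
      Pe[weierCurve a 0, corpus_smoothI ha, theta0 a 0, (corpus_formsI ha).1, γ'] =
        I * Pe[weierCurve a 0, corpus_smoothI ha, theta0 a 0, (corpus_formsI ha).1, γ]) ∧
    (InSpanRel (Sy[weierCurve a 0, corpus_smoothI ha, xθ₀[a, 0], (corpus_formsI ha).2, γ'] -
        (-I) • Sy[weierCurve a 0, corpus_smoothI ha, xθ₀[a, 0], (corpus_formsI ha).2, γ]) ∧
      Pe[weierCurve a 0, corpus_smoothI ha, xθ₀[a, 0], (corpus_formsI ha).2, γ'] =
        -I * Pe[weierCurve a 0, corpus_smoothI ha, xθ₀[a, 0], (corpus_formsI ha).2, γ]) :=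
  cmI_derivations I_sq (corpus_smoothI ha) (corpus_formsI ha).1 (corpus_formsI ha).2 hγ'

/-- The corpus curve `y² = x³ + 1` (tests E1-11, E1-25) is a smooth affine curve over `ℚ̄`. -/
theorem corpus_smoothU : (weierCurve 0 1).IsSmoothAffineCurve :=
  isSmoothAffineCurve 0 1 isAlgebraic_zero isAlgebraic_one (by norm_num [disc])

/-- `θ₀` and `xθ₀` on `y² = x³ + 1` are defined over `ℚ̄`. -/
theorem corpus_formsU : (∀ k, HasAlgCoeffs (theta0 0 1 k)) ∧ ∀ k, HasAlgCoeffs (xθ₀[0, 1] k) :=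
  ⟨hasAlgCoeffs_theta0 0 1 isAlgebraic_zero isAlgebraic_one,
    hasAlgCoeffs_smul_theta0 0 1 isAlgebraic_zero isAlgebraic_one (hasAlgCoeffs_X 0)⟩

/-- **Test E1-11** (`W([ρ]γ) = ρW(γ)`, `H([ρ]γ) = ρ²H(γ)`; verdict `relation`, exhibited): on `y² = x³ + 1`, for
any cube root of unity `u` (`u = ρ, ρ²`), EVERY `C¹` path `γ` with algebraic end points and its image
`γ′ = [u]γ = (u·x∘γ, y∘γ)` on `[0, 1]` (which exists, `exists_cmUPath`):
`(E, θ₀, γ′) − u·(E, θ₀, γ) ∈ ⟨(R1)–(R5)⟩_ℚ̄` and `∫_{γ′} dx/y = u ∫_γ dx/y`;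
`(E, xθ₀, γ′) − u²·(E, xθ₀, γ) ∈ ⟨(R1)–(R5)⟩_ℚ̄` and `∫_{γ′} x dx/y = u² ∫_γ x dx/y`. -/
theorem corpus_cmU {u : ℂ} (hu : u ^ 3 = 1) {γ γ' : CurvePath (weierCurve 0 1)}
    (hγ' : ∀ t ∈ Icc (0 : ℝ) 1, γ'.toFun t = ![u * γ.toFun t 0, γ.toFun t 1]) :
    (InSpanRel (Sy[weierCurve 0 1, corpus_smoothU, theta0 0 1, corpus_formsU.1, γ'] -
        u • Sy[weierCurve 0 1, corpus_smoothU, theta0 0 1, corpus_formsU.1, γ]) ∧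
      Pe[weierCurve 0 1, corpus_smoothU, theta0 0 1, corpus_formsU.1, γ'] =
        u * Pe[weierCurve 0 1, corpus_smoothU, theta0 0 1, corpus_formsU.1, γ]) ∧
    (InSpanRel (Sy[weierCurve 0 1, corpus_smoothU, xθ₀[0, 1], corpus_formsU.2, γ'] -
        (u ^ 2) • Sy[weierCurve 0 1, corpus_smoothU, xθ₀[0, 1], corpus_formsU.2, γ]) ∧
      Pe[weierCurve 0 1, corpus_smoothU, xθ₀[0, 1], corpus_formsU.2, γ'] =
        u ^ 2 * Pe[weierCurve 0 1, corpus_smoothU, xθ₀[0, 1], corpus_formsU.2, γ]) :=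
  cmU_derivations hu corpus_smoothU corpus_formsU.1 corpus_formsU.2 hγ'

end Weierstrass

end Summit.KontsevichZagierPeriods.KzOnePeriods.E1Derivation

end
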